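import Mathlib
import Summits.MatrixMultiplication.Statement
import Summits.MatrixMultiplication.MatrixMultiplication.Theorems.GraphEquationsExactMembersNull
import Summits.MatrixMultiplication.MatrixMultiplication.Theorems.GraphEquationsNullExpMembers
import Summits.MatrixMultiplication.MatrixMultiplication.Theorems.GraphEquationsDeepDeflation
import Summits.MatrixMultiplication.MatrixMultiplication.Theorems.GraphEquationsJetRegularity
import Summits.MatrixMultiplication.MatrixMultiplication.Theorems.GraphEquationsAffineDeflation

/-!
# Graph equations — the e-ENGINE STEP and the level-1 engine (M19k)

The inductive step of the membership-exponent engine (NODE-g32 REV 3/7/8/9), certified: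

* `exactMember_step` — differentiating an EXACT member identity `Σ_o h_o p_o = ι(g)·f_q^{j+1}` along any
  coefficient field `ξ` gives the exact identity
  `Σ_o (D_ξ h_o)·p_o + Σ_o h_o·(D_ξ p_o) = (j+1)·ι(g ξ_q)·f_q^j` over the enlarged family `p ∪ D_ξ p`
  (`exactMember_step_sum`: the `ο ⊕ ο`-indexed form).
* `tensorRank_le_of_sqMembers_affine` — the LEVEL-1 ENGINE (e = 2): tests `t_o ∈ I` of nonscalar length
  `≤ N`, ONE affine field `ξ` whose deflated tests have no constant and no `(a,b)`-linear term (V0/V1 — the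
  truncation of a kernel section at a max-rank base supplies them), and for every coordinate `q` either an
  exact square member `Σ h t = ι(g) f_q²` with `g(0) ξ_q(0) ≠ 0` (FREE coordinate) or a constant combination
  `Σ P_o t_o = f_q` modulo an osculation-null remainder (FORCED coordinate, `oscNull_of_forced`) force
  `R(⟨n,n,n⟩) ≤ 6N`.  No regularity hypothesis, no left inverse, no garbage bookkeeping.
-/

set_option linter.dupNamespace false

noncomputable section

open scoped BigOperators

namespace Summit.MatrixMultiplication.MatrixMultiplication.Theorems.GraphEquations

open MvPolynomial
open Literature.Computability.AlgebraicComplexity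
open Literature.Computability.AlgebraicComplexity.ArithCircuit

variable {n : ℕ}

/-! ## The step on exact member identities -/

/-- **e-ENGINE STEP.** `Σ_o h_o p_o = ι(g) f_q^{j+1}` ⇒
`Σ_o ((D_ξ h_o) p_o + h_o (D_ξ p_o)) = (j+1)·ι(g ξ_q)·f_q^j`. -/
theorem exactMember_step {ο : Type*} [Fintype ο] (ξ : Fin n × Fin n → MvPolynomial (MatMulVars n) ℂ)
    (p h : ο → MvPolynomial (GraphVars n) ℂ) (g : MvPolynomial (MatMulVars n) ℂ) (q : Fin n × Fin n) (j : ℕ)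
    (hid : ∑ o, h o * p o = liftAB n g * generator n q ^ (j + 1)) :
    ∑ o, (derivC ξ (h o) * p o + h o * derivC ξ (p o)) =
      C (((j + 1 : ℕ) : ℂ)) * liftAB n (g * ξ q) * generator n q ^ j := by
  have := congrArg (derivC ξ) hid
  rw [derivC_sum_mul, derivC_liftAB_mul, derivC_pow_succ, derivC_generator] at this
  rw [this, map_mul, Nat.cast_add, Nat.cast_one, map_add, map_natCast, map_one]
  ring

/-- The step, indexed by the enlarged family `p ∪ D_ξ p : ο ⊕ ο`. -/
theorem exactMember_step_sum {ο : Type*} [Fintype ο] (ξ : Fin n × Fin n → MvPolynomial (MatMulVars n) ℂ)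
    (p h : ο → MvPolynomial (GraphVars n) ℂ) (g : MvPolynomial (MatMulVars n) ℂ) (q : Fin n × Fin n) (j : ℕ)
    (hid : ∑ o, h o * p o = liftAB n g * generator n q ^ (j + 1)) :
    ∑ o' : ο ⊕ ο, Sum.elim (fun o => derivC ξ (h o)) h o' * Sum.elim p (fun o => derivC ξ (p o)) o' =
      C (((j + 1 : ℕ) : ℂ)) * liftAB n (g * ξ q) * generator n q ^ j := by
  rw [Fintype.sum_sum_type]
  simp only [Sum.elim_inl, Sum.elim_inr]
  rw [← Finset.sum_add_distrib]
  exact exactMember_step ξ p h g q j hid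

/-! ## The level-1 engine (membership exponent 2) -/

/-- **LEVEL-1 ENGINE (e = 2).**  See the module docstring. -/
theorem tensorRank_le_of_sqMembers_affine {N T : ℕ} (t : Fin T → MvPolynomial (GraphVars n) ℂ)
    (hspan : ∃ gs : List (MvPolynomial (GraphVars n) ℂ), IsNonscalarSeq gs ∧ gs.length ≤ N ∧
      ∀ o, t o ∈ freeSpan {q | q ∈ gs})
    (ht : ∀ o, t o ∈ graphIdeal n)
    (ξ : Fin n × Fin n → MvPolynomial (MatMulVars n) ℂ)
    (hξ : ∀ q, liftAB n (ξ q) ∈ freeSpan (∅ : Set (MvPolynomial (GraphVars n) ℂ)))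
    (hV0 : ∀ o, coeff 0 (derivC ξ (t o)) = 0)
    (hV1 : ∀ o (v : MatMulVars n), coeff (Finsupp.single (Sum.inl v : GraphVars n) 1) (derivC ξ (t o)) = 0)
    (hq : ∀ q : Fin n × Fin n,
      (coeff 0 (ξ q) ≠ 0 ∧ ∃ (g : MvPolynomial (MatMulVars n) ℂ) (h : Fin T → MvPolynomial (GraphVars n) ℂ),
          coeff 0 g ≠ 0 ∧ ∑ o, h o * t o = liftAB n g * generator n q ^ 2) ∨
      (∃ (P : Fin T → ℂ) (r : MvPolynomial (GraphVars n) ℂ),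
          (∀ q' : Fin n × Fin n, coeff (Finsupp.single (Sum.inr q' : GraphVars n) 1) r = 0) ∧
          (∀ i j j' l : Fin n, coeff (Finsupp.single (Sum.inl (Sum.inl (i, j)) : GraphVars n) 1 +
              Finsupp.single (Sum.inl (Sum.inr (j', l)) : GraphVars n) 1) r = 0) ∧
          ∑ o, C (P o) * t o = generator n q + r)) :
    tensorRank (matMulTensor ℂ n n n) ≤ 2 * (3 * N) := by
  classical
  set p : Fin T ⊕ Fin T → MvPolynomial (GraphVars n) ℂ := Sum.elim t fun o => derivC ξ (t o) with hp
  -- nonscalar length of the enlarged family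
  obtain ⟨gs, hns, hlen, hmem⟩ := hspan
  obtain ⟨gs', hns', hlen', hsub, hD⟩ := IsNonscalarSeq.derivC_affine ξ hξ hns
  have hspan' : ∃ gs' : List (MvPolynomial (GraphVars n) ℂ), IsNonscalarSeq gs' ∧
      gs'.length ≤ 3 * N ∧ ∀ o, p o ∈ freeSpan {q | q ∈ gs'} := by
    refine ⟨gs', hns', hlen'.trans (by omega), fun o => ?_⟩
    rcases o with o | o
    · exact hsub _ (hmem o)
    · exact hD _ (hmem o)
  -- (V0), (V1) for the whole family
  have h0 : ∀ o, coeff 0 (p o) = 0 := by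
    rintro (o | o)
    · exact coeff_zero_eq_zero_of_mem_graphIdeal (ht o)
    · exact hV0 o
  have h1 : ∀ o (v : MatMulVars n), coeff (Finsupp.single (Sum.inl v : GraphVars n) 1) (p o) = 0 := by
    rintro (o | o) v
    · exact coeff_single_inl_eq_zero_of_mem_graphIdeal (ht o) v
    · exact hV1 o v
  -- the member identities, coordinate by coordinate
  have hex : ∀ q : Fin n × Fin n, ∃ (hh : Fin T ⊕ Fin T → MvPolynomial (GraphVars n) ℂ)
      (uu rr : MvPolynomial (GraphVars n) ℂ), coeff 0 uu ≠ 0 ∧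
        (∀ q' : Fin n × Fin n, coeff (Finsupp.single (Sum.inr q' : GraphVars n) 1) rr = 0) ∧
        (∀ i j j' l : Fin n, coeff (Finsupp.single (Sum.inl (Sum.inl (i, j)) : GraphVars n) 1 +
            Finsupp.single (Sum.inl (Sum.inr (j', l)) : GraphVars n) 1) rr = 0) ∧
        ∑ o, hh o * p o = uu * generator n q + rr := by
    intro q
    rcases hq q with ⟨hξq, g, h, hg, hid⟩ | ⟨P, r, hrc, hrab, hid⟩
    · refine ⟨Sum.elim (fun o => derivC ξ (h o)) h, C (((1 + 1 : ℕ) : ℂ)) * liftAB n (g * ξ q), 0, ?_,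
        fun _ => coeff_zero _, fun _ _ _ _ => coeff_zero _, ?_⟩
      · rw [coeff_zero_mul_eq, coeff_zero_C, coeff_zero_liftAB, coeff_zero_mul_eq]
        exact mul_ne_zero (by norm_num) (mul_ne_zero hg hξq)
      · rw [add_zero, hp, exactMember_step_sum ξ t h g q 1 hid, pow_one]
    · refine ⟨Sum.elim (fun o => C (P o)) fun _ => 0, 1, r, by simp, hrc, hrab, ?_⟩
      rw [Fintype.sum_sum_type]
      simp only [hp, Sum.elim_inl, Sum.elim_inr, zero_mul, Finset.sum_const_zero, add_zero, one_mul]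
      exact hid
  choose hh uu rr huu hrc hrab hid using hex
  exact tensorRank_le_of_exactMembers_mod p hspan' h0 h1 hh uu huu rr hrc hrab hid

end Summit.MatrixMultiplication.MatrixMultiplication.Theorems.GraphEquations

end
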